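import Mathlib
import HarnessLib
import Summits.ValiantsHypothesis.ValiantsHypothesis.Theses.MonotoneRestoration
import Literature.Computability.AlgebraicComplexity.SymmetricArithCircuit
import Summits.ValiantsHypothesis.ValiantsHypothesis.Theorems.MonotoneRestorationQP.Negative.LoadBearing
import Summits.ValiantsHypothesis.ValiantsHypothesis.Theorems.MonotoneRestorationMonotoneRestorationQPZetaEntrySymmetric
import Summits.ValiantsHypothesis.ValiantsHypothesis.Theorems.MonotoneRestorationMonotoneRestorationQPCoeffMemAdjoinConstants
import Summits.ValiantsHypothesis.ValiantsHypothesis.Theorems.MonotoneRestorationMonotoneRestorationQPCardLeOfAlgebraicIndependentAdjoin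
import Summits.ValiantsHypothesis.ValiantsHypothesis.Theorems.MonotoneRestorationMonotoneRestorationQPCoordsMemOfCoeffsMem
import Summits.ValiantsHypothesis.ValiantsHypothesis.Theorems.MonotoneRestorationMonotoneRestorationQPExistsAlgebraicIndependentComplex

/-! # Route MonotoneRestoration — crux `MonotoneRestorationQP`: DIMENSION COUNTING
(stmt-ValiantsHypothesis-15886, line Sketch v10, lead c5, cycle 2)

**A circuit-SIZE lower bound that is not an orbit bound: `ℚ`-generic elements of the span of the
`2^n` products `Π_{k ∈ T} e_{k+1}` (`T ⊆ {0, …, n-1}`) of elementary symmetric polynomials of the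
`n²` matrix entries need `≥ 2^n` gates in ANY circuit over `ℂ`.**

Every instrument for square-symmetric circuits in the tree bounds ORBITS (supports, counting width:
Dawar–Wilsenach Thms 6.4/7.1) or DEGREE (`Negative/UniformExponentFalse`,
`Negative/OrbitCompressionFalseWithoutVP`). The census of the crux (strategist N6; c5 memo-8 §1)
asked for a size bound beyond both, to make precise that the `VP` hypothesis of the compression half
L2 (`stub_orbitCompression`) is load-bearing EVEN AT POLYNOMIAL DEGREE. Dimension counting over `ℚ`
provides it:

* N1 `stub_coeff_mem_adjoin_constants` — every coefficient of every gate value lies in the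
  `ℚ`-subalgebra `S` of `ℂ` generated by the circuit's constants;
* N2 `stub_card_le_of_algebraicIndependent_adjoin` — an algebraically independent family inside a
  subalgebra generated by `r` numbers has `≤ r` members (transcendence degree);
* N3 `stub_coords_mem_of_coeffs_mem` — coordinates in a `ℚ`-defined linearly independent family
  are in `S` when the coefficients are;
* N4 `stub_exists_algebraicIndependent_complex` — `ℂ` has arbitrarily large algebraically
  independent families.

Assembled here (no new definitions; the products are written out): `esymmProd_linearIndependent`
(the `2^N` products are `ℚ`-linearly independent: fundamental theorem `esymmAlgHom_injective` +
independence of the squarefree monomials), `card_ge_of_generic` (the bound `2^N ≤ |G|` for every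
circuit computing a generic combination), and the registered negative
`symmetricCheapSpan_not_qpSize`: there is a family `f_n`, symmetric in ALL entries (so
matrix-symmetric), of total degree `≤ n²`, inside the algebra generated by the `e_k` of the entries
(each of which has a polynomial-size square-symmetric circuit, `zeta_symmetric_esymm`), such that
for every quasi-polynomial bound some `f_n` has NO circuit of that size — symmetric or not.
Informally (not certified here: it would need the rigidity analysis of the composite circuits) these
`f_n` DO have square-symmetric circuits all of whose gate orbits have size `≤ n²`, so "L2 minus
`IsVPFamily`" fails at polynomial degree as well.
-/

noncomputable section

-- `Summit.ValiantsHypothesis.ValiantsHypothesis.…` is the tree's mandated namespace (Sub = Summit).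
set_option linter.dupNamespace false

namespace Summit.ValiantsHypothesis.ValiantsHypothesis.Theorems

open Literature.Computability.AlgebraicComplexity



/-! ### The `2^N` products of elementary symmetric polynomials -/

section Products

variable (X : Type) [Fintype X] [DecidableEq X]

omit [DecidableEq X] in
/-- The product `Π_{k ∈ T} e_{k+1}` of elementary symmetric polynomials is the image of the
squarefree monomial `y^T` under the fundamental-theorem map `esymmAlgHom` (followed by the inclusion
of the symmetric subalgebra). [folklore] -/
theorem esymmProd_eq_val_esymmAlgHom (N : ℕ) (T : Finset (Fin N)) :
    ∏ k ∈ T, MvPolynomial.esymm X ℚ (k + 1) =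
      (MvPolynomial.symmetricSubalgebra X ℚ).val
        (MvPolynomial.esymmAlgHom X ℚ N
          (MvPolynomial.monomial (∑ k ∈ T, Finsupp.single k 1) 1)) := by
  have happ : ∀ k : Fin N, (∑ k' ∈ T, Finsupp.single k' (1 : ℕ)) k = if k ∈ T then 1 else 0 := by
    intro k
    rw [Finsupp.finsetSum_apply]
    simp only [Finsupp.single_apply]
    rw [Finset.sum_ite_eq']
  rw [MvPolynomial.esymmAlgHom, MvPolynomial.aeval_monomial, map_one, one_mul,
    Finsupp.prod_of_support_subset _ (s := T) ?_ _ (fun k _ => by rw [pow_zero]), map_prod]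
  · refine Finset.prod_congr rfl fun k hk => ?_
    rw [happ, if_pos hk, pow_one]
    rfl
  · intro k hk
    rw [Finsupp.mem_support_iff, happ] at hk
    by_contra h
    exact hk (if_neg h)

omit [DecidableEq X] in
/-- The products `Π_{k ∈ T} e_{k+1}` are symmetric in all variables. [folklore] -/
theorem rename_esymmProd (R : Type) [CommSemiring R] (N : ℕ) (T : Finset (Fin N))
    (π : Equiv.Perm X) :
    MvPolynomial.rename π (∏ k ∈ T, MvPolynomial.esymm X R (k + 1)) =
      ∏ k ∈ T, MvPolynomial.esymm X R (k + 1) := by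
  rw [map_prod]
  exact Finset.prod_congr rfl fun k _ => by rw [MvPolynomial.rename_esymm]

omit [DecidableEq X] in
/-- Changing the coefficients of the products. [folklore] -/
theorem map_esymmProd (N : ℕ) (T : Finset (Fin N)) :
    MvPolynomial.map (algebraMap ℚ ℂ) (∏ k ∈ T, MvPolynomial.esymm X ℚ (k + 1)) =
      ∏ k ∈ T, MvPolynomial.esymm X ℂ (k + 1) := by
  rw [map_prod]
  exact Finset.prod_congr rfl fun k _ => by rw [MvPolynomial.map_esymm]

/-- The products `Π_{k ∈ T} e_{k+1}`, `T ⊆ Fin N`, have total degree `≤ N²`. [folklore] -/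
theorem totalDegree_esymmProd_le (R : Type) [CommSemiring R] (N : ℕ) (T : Finset (Fin N)) :
    (∏ k ∈ T, MvPolynomial.esymm X R ((k : ℕ) + 1)).totalDegree ≤ N * N := by
  refine (MvPolynomial.totalDegree_finsetProd _ _).trans ?_
  calc ∑ k ∈ T, (MvPolynomial.esymm X R ((k : ℕ) + 1)).totalDegree ≤ ∑ k ∈ T, ((k : ℕ) + 1) :=
        Finset.sum_le_sum fun k _ => (zeta_esymm_isHomogeneous R X (k + 1)).totalDegree_le
    _ ≤ ∑ _k ∈ T, N := Finset.sum_le_sum fun k _ => k.isLt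
    _ ≤ ∑ _k : Fin N, N := Finset.sum_le_sum_of_subset_of_nonneg (Finset.subset_univ T)
        (fun _ _ _ => Nat.zero_le _)
    _ = N * N := by simp

omit [DecidableEq X] in
/-- **The `2^N` products `Π_{k ∈ T} e_{k+1}` are `ℚ`-linearly independent** when `N ≤ |X|`: the
squarefree monomials `y^T` form a sub-family of the monomial basis of `ℚ[y_0, …, y_{N-1}]` along the
injective `T ↦ 1_T`, and `esymmAlgHom` followed by the inclusion is injective
(`MvPolynomial.esymmAlgHom_injective`, the fundamental theorem of symmetric polynomials). [folklore] -/
theorem esymmProd_linearIndependent (N : ℕ) (hN : N ≤ Fintype.card X) :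
    LinearIndependent ℚ fun T : Finset (Fin N) => ∏ k ∈ T, MvPolynomial.esymm X ℚ (k + 1) := by
  -- the exponent map `T ↦ 1_T` is injective
  let indic : Finset (Fin N) → (Fin N →₀ ℕ) := fun T => ∑ k ∈ T, Finsupp.single k 1
  have happ : ∀ (T : Finset (Fin N)) (k : Fin N), indic T k = if k ∈ T then 1 else 0 := by
    intro T k
    simp only [indic]
    rw [Finsupp.finsetSum_apply]
    simp only [Finsupp.single_apply]
    rw [Finset.sum_ite_eq']
  have hinj : Function.Injective indic := by
    intro T T' h
    ext k
    have h1 := congrArg (fun s => s k) h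
    simp only [happ] at h1
    by_cases hk : k ∈ T <;> by_cases hk' : k ∈ T' <;> simp_all
  -- squarefree monomials are linearly independent
  have hmono : LinearIndependent ℚ fun T : Finset (Fin N) =>
      (MvPolynomial.monomial (indic T) (1 : ℚ) : MvPolynomial (Fin N) ℚ) := by
    have h := (MvPolynomial.basisMonomials (Fin N) ℚ).linearIndependent.comp indic hinj
    rw [MvPolynomial.coe_basisMonomials] at h
    exact h
  -- push through the injective fundamental-theorem map
  let φ : MvPolynomial (Fin N) ℚ →ₗ[ℚ] MvPolynomial X ℚ :=
    ((MvPolynomial.symmetricSubalgebra X ℚ).val.comp (MvPolynomial.esymmAlgHom X ℚ N)).toLinearMap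
  have hφ : LinearMap.ker φ = ⊥ := by
    refine LinearMap.ker_eq_bot.2 ?_
    change Function.Injective
      ((MvPolynomial.symmetricSubalgebra X ℚ).val ∘ MvPolynomial.esymmAlgHom X ℚ N)
    exact Subtype.val_injective.comp (MvPolynomial.esymmAlgHom_injective ℚ hN)
  have h := hmono.map' φ hφ
  have hfun : (fun T : Finset (Fin N) => ∏ k ∈ T, MvPolynomial.esymm X ℚ (k + 1)) =
      ⇑φ ∘ fun T => (MvPolynomial.monomial (indic T) (1 : ℚ) : MvPolynomial (Fin N) ℚ) :=
    funext fun T => esymmProd_eq_val_esymmAlgHom X N T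
  rw [hfun]
  exact h

end Products

/-! ### The lower bound -/

/-- **SIZE LOWER BOUND BY DIMENSION COUNTING.** Let `N ≤ |X|` and let `(c_T)_{T ⊆ Fin N}` be
algebraically independent over `ℚ`. Then EVERY labelled arithmetic circuit over `ℂ` (any variables
`X`, any outputs, symmetric or not) computing `Σ_T c_T · Π_{k ∈ T} e_{k+1}` at some gate has at least
`2^N` gates: its coefficients lie in the `ℚ`-subalgebra generated by its `≤ |G|` constants (N1), hence
so do the `c_T` (N3, by `esymmProd_linearIndependent`), which forces `2^N ≤ |G|` (N2). [new] -/
theorem card_ge_of_generic {X : Type} [Fintype X] [DecidableEq X] {N : ℕ} (hN : N ≤ Fintype.card X)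
    (c : Finset (Fin N) → ℂ) (hc : AlgebraicIndependent ℚ c) {Y G : Type} [Fintype G]
    (C : LabelledArithCircuit ℂ X Y G) (g : G)
    (hg : C.eval g = ∑ T, c T • MvPolynomial.map (algebraMap ℚ ℂ)
      (∏ k ∈ T, MvPolynomial.esymm X ℚ (k + 1))) :
    2 ^ N ≤ Fintype.card G := by
  classical
  -- enumerate the constants of `C` by `Fin |G|` (padding with `0`)
  let eG : G ≃ Fin (Fintype.card G) := Fintype.equivFin G
  let a : Fin (Fintype.card G) → ℂ := fun i =>
    match C.label (eG.symm i) with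
    | .const c' => c'
    | _ => 0
  have hsub : {c' : ℂ | ∃ g' : G, C.label g' = CircuitLabel.const c'} ⊆ Set.range a := by
    rintro c' ⟨g', hg'⟩
    refine ⟨eG g', ?_⟩
    simp only [a, Equiv.symm_apply_apply, hg']
  -- N1: coefficients in the algebra of constants
  have hcoef : ∀ m, MvPolynomial.coeff m (C.eval g) ∈ Algebra.adjoin ℚ (Set.range a) := fun m =>
    Algebra.adjoin_mono hsub (stub_coeff_mem_adjoin_constants C g m)
  -- reindex the family by `Fin (2^N)`
  let eT : Finset (Fin N) ≃ Fin (2 ^ N) :=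
    Fintype.equivFinOfCardEq (by rw [Fintype.card_finset, Fintype.card_fin])
  let b : Fin (2 ^ N) → MvPolynomial X ℚ := fun i => ∏ k ∈ eT.symm i, MvPolynomial.esymm X ℚ (k + 1)
  have hlin : LinearIndependent ℚ b := (esymmProd_linearIndependent X N hN).comp _ eT.symm.injective
  have hsum : C.eval g = ∑ i, (c ∘ eT.symm) i • MvPolynomial.map (algebraMap ℚ ℂ) (b i) := by
    rw [hg]
    exact (Equiv.sum_comp eT.symm (fun T => c T • MvPolynomial.map (algebraMap ℚ ℂ)
      (∏ k ∈ T, MvPolynomial.esymm X ℚ (k + 1)))).symm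
  -- N3: the coordinates `c_T` are in the algebra of constants
  have hmem : ∀ i, (c ∘ eT.symm) i ∈ Algebra.adjoin ℚ (Set.range a) :=
    stub_coords_mem_of_coeffs_mem b hlin _ (c ∘ eT.symm) (fun m => by rw [← hsum]; exact hcoef m)
  -- N2: transcendence degree
  exact stub_card_le_of_algebraicIndependent_adjoin a (c ∘ eT.symm) (hc.comp _ eT.symm.injective) hmem

/-! ### The registered negative -/

/-- **SYMMETRIC-CHEAP SPANS OF EXPONENTIAL CIRCUIT SIZE (the dimension-counting instrument).**
There is a family `f_n ∈ ℂ[x_ij : i, j < n]` such that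
(i) `f_n` is invariant under ALL permutations of the entries (in particular matrix-symmetric),
(ii) `deg f_n ≤ n²`,
(iii) `f_n` lies in the algebra generated by the elementary symmetric polynomials of the entries —
each of which has a polynomial-size square-symmetric circuit (`zeta_symmetric_esymm`) —, and
(iv) for every quasi-polynomial bound `2^{(log₂ n + c)^c}` there is an `n` such that NO labelled
arithmetic circuit over `ℂ` of that size computes `f_n` (symmetric or not).
Witness: `f_n = Σ_{T ⊆ Fin n} c_T Π_{k ∈ T} e_{k+1}` with `ℚ`-algebraically independent `c_T` (N4);
every circuit computing it has `≥ 2^n` gates (`card_ge_of_generic`) while `(log₂ n + c)^c < n`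
eventually (`polylog_pow_lt_linear`). This is the tree's first symmetric-size lower bound beyond
orbit and degree bounds; it shows that orbit-to-size compression (L2) cannot hold for arbitrary
polynomial-degree families in the span of symmetric-cheap generators: the `VP` hypothesis of L2 is
load-bearing at polynomial degree. [new] -/
theorem symmetricCheapSpan_not_qpSize :
    ∃ f : (n : ℕ) → MvPolynomial (Fin n × Fin n) ℂ,
      (∀ (n : ℕ) (π : Equiv.Perm (Fin n × Fin n)), MvPolynomial.rename π (f n) = f n) ∧
      (∀ n : ℕ, (f n).totalDegree ≤ n * n) ∧
      (∀ n : ℕ, f n ∈ Algebra.adjoin ℂ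
        (Set.range fun k : ℕ => MvPolynomial.esymm (Fin n × Fin n) ℂ k)) ∧
      ∀ c : ℕ, ∃ n : ℕ, ∀ (G : Type) [Fintype G]
        (C : LabelledArithCircuit ℂ (Fin n × Fin n) Unit G),
        C.eval (C.output ()) = f n → 2 ^ ((Nat.log 2 n + c) ^ c) < Fintype.card G := by
  classical
  -- generic coefficients, for every `n`
  choose coef hcoef using fun n => stub_exists_algebraicIndependent_complex (2 ^ n)
  let eT : (n : ℕ) → Finset (Fin n) ≃ Fin (2 ^ n) := fun n =>
    Fintype.equivFinOfCardEq (by rw [Fintype.card_finset, Fintype.card_fin])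
  let c : (n : ℕ) → Finset (Fin n) → ℂ := fun n T => coef n (eT n T)
  have hc : ∀ n, AlgebraicIndependent ℚ (c n) := fun n => (hcoef n).comp _ (eT n).injective
  let f : (n : ℕ) → MvPolynomial (Fin n × Fin n) ℂ := fun n =>
    ∑ T, c n T • MvPolynomial.map (algebraMap ℚ ℂ)
      (∏ k ∈ T, MvPolynomial.esymm (Fin n × Fin n) ℚ (k + 1))
  refine ⟨f, fun n π => ?_, fun n => ?_, fun n => ?_, fun c₀ => ?_⟩
  · -- (i) symmetry in all entries
    simp only [f, map_sum, map_smul]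
    refine Finset.sum_congr rfl fun T _ => ?_
    rw [← MvPolynomial.map_rename, rename_esymmProd]
  · -- (ii) degree
    refine (MvPolynomial.totalDegree_finsetSum _ _).trans (Finset.sup_le fun T _ => ?_)
    refine (MvPolynomial.totalDegree_smul_le _ _).trans ?_
    rw [map_esymmProd]
    exact totalDegree_esymmProd_le _ ℂ n T
  · -- (iii) inside the algebra of the `e_k` of the entries
    refine Subalgebra.sum_mem _ fun T _ => Subalgebra.smul_mem _ ?_ _
    rw [map_esymmProd]
    exact Subalgebra.prod_mem _ fun k _ => Algebra.subset_adjoin ⟨(k : ℕ) + 1, rfl⟩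
  · -- (iv) no quasi-polynomial size
    obtain ⟨n₀, hn₀⟩ :=
      MonotoneRestorationQP.Negative.polylog_pow_lt_linear c₀ (show (0 : ℝ) < 1 from one_pos)
    refine ⟨max n₀ 1, fun G _ C hC => ?_⟩
    have hn1 : 1 ≤ max n₀ 1 := le_max_right _ _
    have hN : max n₀ 1 ≤ Fintype.card (Fin (max n₀ 1) × Fin (max n₀ 1)) := by
      rw [Fintype.card_prod, Fintype.card_fin]
      nlinarith
    have hge := card_ge_of_generic hN (c (max n₀ 1)) (hc _) C (C.output ()) hC
    have hlt : (Nat.log 2 (max n₀ 1) + c₀) ^ c₀ < max n₀ 1 := by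
      have h := hn₀ (max n₀ 1) (le_max_left _ _)
      rw [one_mul] at h
      exact_mod_cast h
    exact (Nat.pow_lt_pow_right (by norm_num) hlt).trans_le hge

end Summit.ValiantsHypothesis.ValiantsHypothesis.Theorems

end
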